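import Summits.QuantumFields.YangMills.Theorems.BalabanUVNodesN15KingModelFullPropagatorN15At
import Summits.QuantumFields.YangMills.Theorems.BalabanUVNodesN15KingModelMinimizerNode
import Summits.QuantumFields.YangMills.Theorems.BalabanUVNodesN15PairedFamilyGuard

/-!
# BalabanUVNodes ∕ N15 — THE KING-MODEL RUNG, PART Λ: THE RUNG's THREE `NE2Carriers` BUNDLES PASS dag-n15-w2's LIVENESS GUARD `PairedFamilyGuard.Live`
# AS THEY STAND, AND CARRY `N15At` HYPOTHESIS-FREE — three more positive controls for the K3 v2 pin, one of them the FULL `A = 0` propagator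
# (Track A, DAG node N15 = NE2; FAN-OUT v1.1 §N15 s3 «KING-MODEL ∕ RIEMANN-KERNEL RUNG»)

HONEST FRAMING.  Count-neutral bookkeeping (cell `pub-ymgap`, seat `pub-ymgap-dag-n15-e` g11; `--supports stmt-QuantumFields-20544 --as helper` = K3⁷
`SpineGivenEndpointR13SepCoPH`).  No new estimate and no new object.  dag-n15-w2's `BalabanUVNodesN15PairedFamilyGuard` (p584544) typed the guard
`Live (c : NE2Carriers)` — size threshold `gf.M` and scale count `gc.k` JOINTLY COFINAL over the family, the trivial background (3.35)∧(3.36)-regular, the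
unit-lattice region met — which EXCLUDES the carrier junk on which `NE2PlusOperator ∧ NE2PlusSite` hold for arbitrary kernels (`ne2PlusOperator_of_gf_M_lt`,
dag-ref-B READ-335's probe; every `gf.M = 1` family fails: `not_live_tgInstance_comp`), with ONE positive control so far (`live_and_n15At_knitCarriers`, dag-n15-a's
g0 Landau-gauge knit family).  THIS FILE: the King-model rung's three bundles — g0 `kingVolCarriers` (top-scale piece ∕ top-piece site kernel ∕ block covariance),
g2 `kingVolCarriersH` (site layer = King's minimiser `ℋ_K`), Q6 `fullPropCarriersEta` (operator layer = the FULL `A = 0` propagator with η-lattice test functions)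
— were indexed from the start by `KingVolIndex` (volume exponent `m`, number of levels `K ≥ 1`, size letter `M ≥ 1` as DATA), so they PASS `Live` verbatim, and
the rung's `n15At_kingModelRung` ∕ `n15At_kingModelRungH` ∕ `n15At_fullPropEta` give `Live c ∧ N15At c` on each: the K4 statement holds on LIVE King-model families,
not on junk.  What this is NOT (v1.0.2 wording, dag-ref-B READ-781 NIT-L1): not `KeyedLive` AT THE READING OF RECORD — §3 (v1.1) does build SOME `RateReading₁₃CoPH`
(constant in the Stage-13 tuple and in the run length, NE2 objects = the rung's full-propagator bundle, «don't-care» fillers elsewhere) that passes `KeyedLive` and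
carries `N15At`: a POSITIVE CONTROL for the K3 v2 slot, whereas the reading of record ∕ the pin of `ne2` by name (`N15PinnedSized`) is NODE 00's ∕ the plan's and is
not built here —; not a pin of `ne2` by name; not Bałaban's `G(U)`.  THE SIZE GUARD IS A QUANTIFIER, NOT AN ESTIMATE (dag-ref-J READ-178 reading note A5, which holds
for every King-rung family — indices `KingVolIndex`, `EtaLatIdx`, `KingBgIdx`; carriers `torusOpInstance`, `etaLatGeo`, `unitTorusGeoS`): the size letter `Msz` is
INERT in the carriers (it is the geometry's `M` field only; `dist = tdistT`; no rung operator depends on it), so uniformity in `M` is free and `M·α₀ ≤ a₀` is live only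
as a cofinal datum; Bałaban's M-dependent small-field window is exactly what the rung does NOT touch.  NE2⁺ NOT PRINTED ∕ not proved; N15 NOT discharged; count-neutral; nothing continuum ∕ ℝ⁴ ∕ OS ∕ mass-gap ∕ Clay.  0 `sorry`, 0 `def`, standard axioms.
v1.0.2 = docstring-only edition of v1.1 (p587186 + p590020): this header paragraph reworded; every declaration byte-identical.
Locators: [Balaban1985BackgroundPropagators] Thm 3.1 p. 397 («for M ≥ M₁»: the size guard), (3.35)–(3.36) p. 396; [King1986] (2.13) p. 653, Prop. 3.8 p. 664, (4.41)–(4.44) p. 675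
(the objects of the three bundles).
-/

noncomputable section

namespace Summit.QuantumFields.YangMills.BalabanUVNodes.N15KingModelRung.Curved

open Literature.MathematicalPhysics.QuantumFieldTheory.Balaban1983to89
open Literature.MathematicalPhysics.QuantumFieldTheory.Balaban1983to89.T4EtaRate (NE2ZeroOperator)
open Summit.QuantumFields.YangMills.BalabanUVNodes.N15.PairedFamilyGuard (Live ne2ZeroOperator_of_live)
open Summit.QuantumFields.YangMills.BalabanUVNodes.N15KingModelRung (KingVolIndex kingVolCarriers kingVolCarriersH n15At_kingModelRung n15At_kingModelRungH)
open YMDAG.UVSplit (NE2Carriers N15At)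

variable (L : ℕ) [NeZero L]

/-! ## §1 The three King-model bundles are LIVE -/

/-- The King-volume index at a prescribed size letter and level count: `(m, K, M) = (0, max k₀ 1, max M₅ 1)`. [folklore] -/
theorem exists_kingVolIndex_ge (d : ℕ) (M₅ : ℝ) (k₀ : ℕ) : ∃ j : KingVolIndex d, M₅ ≤ j.Msz ∧ k₀ ≤ j.K :=
  ⟨⟨0, max k₀ 1, le_max_right _ _, max M₅ 1, le_max_right _ _⟩, le_max_left _ _, le_max_left _ _⟩

/-- **g0's BUNDLE IS LIVE**: `kingVolCarriers` (operator layer = King's top-scale piece `G^η_{(K)}`, site layer = its base-point kernel, unit layer = `(Δ^{(K)})⁻¹`)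
passes dag-n15-w2's guard — its fine instances' size letter IS the index datum `M` and its coarse instances' scale count IS the index datum `K`, both unbounded;
one-point backgrounds are regular by definition; `inΛ ≡ True` on the non-empty unit torus. [cite: Balaban1985BackgroundPropagators, Thm 3.1 p.397 («for M ≥ M₁»)] -/
theorem live_kingVolCarriers (a m2 c35 p : ℝ) : Live (kingVolCarriers L a m2 c35 p) := by
  refine ⟨fun M₅ k₀ => ?_, fun _ _ _ => ⟨trivial, trivial⟩, fun i => ⟨fun _ => 0, trivial⟩⟩
  obtain ⟨j, hM, hk⟩ := exists_kingVolIndex_ge 3 M₅ k₀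
  exact ⟨j, hM, hk⟩

/-- **g2's BUNDLE IS LIVE**: `kingVolCarriersH` (site layer = King's minimiser `ℋ_K`) passes the guard, same reason. [cite: Balaban1985BackgroundPropagators, Thm 3.1 p.397 («for M ≥ M₁»)] -/
theorem live_kingVolCarriersH (a m2 c35 p : ℝ) : Live (kingVolCarriersH L a m2 c35 p) := by
  refine ⟨fun M₅ k₀ => ?_, fun _ _ _ => ⟨trivial, trivial⟩, fun i => ⟨fun _ => 0, trivial⟩⟩
  obtain ⟨j, hM, hk⟩ := exists_kingVolIndex_ge 3 M₅ k₀
  exact ⟨j, hM, hk⟩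

/-- **Q6's BUNDLE IS LIVE**: `fullPropCarriersEta` (operator layer = the FULL `A = 0` propagator `A₀⁻¹` with η-lattice test functions, PART Q5's `etaLatInstance` along
`kvIdx`) passes the guard, same reason (`etaLatGeo`'s size field is the index's `M`, its scale count the index's `K`). [cite: Balaban1985BackgroundPropagators, Thm 3.1 p.397 («for M ≥ M₁»); King1986, (2.13) p.653] -/
theorem live_fullPropCarriersEta (a m2 : ℝ) (hm : 0 < m2) (c35 p : ℝ) : Live (fullPropCarriersEta L a m2 hm c35 p) := by
  refine ⟨fun M₅ k₀ => ?_, fun _ _ _ => ⟨trivial, trivial⟩, fun i => ⟨fun _ => 0, trivial⟩⟩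
  obtain ⟨j, hM, hk⟩ := exists_kingVolIndex_ge 3 M₅ k₀
  exact ⟨j, hM, hk⟩

/-! ## §2 … and carry `N15At`: the K4 statement on LIVE King-model families -/

/-- ★ **LIVE ∧ `N15At`, g0 EDITION** (odd `L ≥ 3`, `a, m² > 0`, `0 < γ ≤ 1`, every `c35`, `p`). [cite: King1986, Prop. 3.8 (3.71) p.664, (4.41)–(4.44) p.675; Balaban1985BackgroundPropagators, Thm 3.1 (3.42) p.397 (quantifier template)] -/
theorem live_and_n15At_kingVolCarriers (hLodd : Odd L) (hL : 2 ≤ L) {a m2 : ℝ} (ha : 0 < a) (hm : 0 < m2) {γ : ℝ} (hγ0 : 0 < γ) (hγ1 : γ ≤ 1)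
    (c35 p : ℝ) : Live (kingVolCarriers L a m2 c35 p) ∧ N15At (kingVolCarriers L a m2 c35 p) :=
  ⟨live_kingVolCarriers L a m2 c35 p, n15At_kingModelRung L hLodd hL ha hm hγ0 hγ1 c35 p⟩

/-- ★ **LIVE ∧ `N15At`, H-KERNEL EDITION**. [cite: King1986, Prop. 3.8 (3.71) p.664; Balaban1985BackgroundPropagators, (3.133) p.422 (quantifier template)] -/
theorem live_and_n15At_kingVolCarriersH (hLodd : Odd L) (hL : 2 ≤ L) {a m2 : ℝ} (ha : 0 < a) (hm : 0 < m2) {γ : ℝ} (hγ0 : 0 < γ) (hγ1 : γ ≤ 1)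
    (c35 p : ℝ) : Live (kingVolCarriersH L a m2 c35 p) ∧ N15At (kingVolCarriersH L a m2 c35 p) :=
  ⟨live_kingVolCarriersH L a m2 c35 p, n15At_kingModelRungH L hLodd hL ha hm hγ0 hγ1 c35 p⟩

/-- ★★ **LIVE ∧ `N15At`, FULL-PROPAGATOR EDITION**: the K4 by-name statement `N15At` holds on a family that PASSES dag-n15-w2's liveness guard and whose operator
layer is King's FULL `A = 0` propagator (PART Q5 ∕ Q6), site layer King's `ℋ_K`, unit layer `(Δ^{(K)})⁻¹` — hypothesis-free; a positive control for the K3 v2 pin from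
genuine multi-level objects (the other one in the tree: dag-n15-a's `live_and_n15At_knitCarriers`). [cite: King1986, (2.13) p.653, Theorem 3.3 (3.7) p.658, Prop. 3.8 (3.71) p.664, (4.41) p.675; Balaban1985BackgroundPropagators, Thm 3.1 (3.42) p.397 + (3.133) p.422 + Thm 3.15 (3.187) p.432 (quantifier templates)] -/
theorem live_and_n15At_fullPropCarriersEta (hLodd : Odd L) (hL : 2 ≤ L) {a m2 : ℝ} (ha : 0 < a) (hm : 0 < m2) {γ : ℝ} (hγ0 : 0 < γ) (hγ1 : γ ≤ 1)
    (c35 p : ℝ) : Live (fullPropCarriersEta L a m2 hm c35 p) ∧ N15At (fullPropCarriersEta L a m2 hm c35 p) :=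
  ⟨live_fullPropCarriersEta L a m2 hm c35 p, n15At_fullPropEta L hLodd hL ha hm hγ0 hγ1 c35 p⟩

/-- Consequence through the guard's own §3 (`ne2ZeroOperator_of_live`): on the live full-propagator bundle the «+» layer read at the trivial background along a
cofinal sub-family gives back NE2⁰'s operator layer — consistent with PART Q5's direct `ne2ZeroOperator_fullProp`. [cite: Balaban1985BackgroundPropagators, Thm 3.1 (3.42) p.397 (quantifier template)] -/
theorem ne2ZeroOperator_fullPropCarriersEta (hLodd : Odd L) (hL : 2 ≤ L) {a m2 : ℝ} (ha : 0 < a) (hm : 0 < m2) {γ : ℝ} (hγ0 : 0 < γ) (hγ1 : γ ≤ 1)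
    (c35 p : ℝ) : NE2ZeroOperator (fullPropCarriersEta L a m2 hm c35 p).pi (fullPropCarriersEta L a m2 hm c35 p).Kop :=
  ne2ZeroOperator_of_live (live_and_n15At_fullPropCarriersEta L hLodd hL ha hm hγ0 hγ1 c35 p).2
    (live_and_n15At_fullPropCarriersEta L hLodd hL ha hm hγ0 hγ1 c35 p).1

/-! ## §3 (v1.1) A Stage-13 READING whose NE2 objects are the King-model full-propagator bundle passes `KeyedLive` and carries `N15At` -/

section Keyed

open Literature.MathematicalPhysics.QuantumFieldTheory.Balaban1983to89.T4Continuum (T4Family ULoop)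
open Node00 (Stage13HParams NE2Objects₁₁ nonempty_rateObjects₁₁)
open Summit.QuantumFields.YangMills.BalabanUVNodes.N15.PairedFamilyGuard (KeyedLive)
open YMDAG.UVSplit (NE1pCarriers rateCarriersOfRecord₁₃CoPH RateReading₁₃CoPH)

variable {N : ℕ} [NeZero N]

/-- ★★ **A SECOND KEYED POSITIVE CONTROL, FROM THE KING MODEL** (twin of dag-n15-w2's `exists_reading_keyedLive_n15At`, whose NE2 objects were dag-n15-a's Landau-gauge knit
family): SOME Stage-13 reading passes `KeyedLive` at the bundle of record AND carries `N15At` there, for every run-length selector — the reading whose NE2 objects at every tuple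
and run length are the rung's FULL-PROPAGATOR bundle `fullPropCarriersEta` (operator layer King's full `A = 0` propagator with its PROVED η-rates, site layer `ℋ_K`, unit layer
`(Δ^{(K)})⁻¹`); the other rate objects are RR-1's sanity inhabitant and the empty dressed tower («don't-care» fillers of NO content, displayed in the proof).  So the keyed
hypothesis shape of K3 v2's N15 slot is inhabited by a family whose three layers are DECIDED rates of genuine multi-level objects — not a pin of Bałaban's `ne2` by name,
not the record's NODE-00 objects; count-neutral. [cite: King1986, (2.13) p.653, Prop. 3.8 (3.71) p.664, (4.41) p.675 (objects); Balaban1985BackgroundPropagators, Thm 3.1 p.397 (quantifier template)] -/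
theorem exists_reading_keyedLive_n15At_king (hLodd : Odd L) (hL : 2 ≤ L) {a m2 : ℝ} (ha : 0 < a) (hm : 0 < m2) {γ : ℝ} (hγ0 : 0 < γ) (hγ1 : γ ≤ 1)
    (c35 p : ℝ) :
    ∃ 𝔯 : RateReading₁₃CoPH N, ∀ ksel : (F : T4Family) → (θ : Stage13HParams F N) → θ.Provisos₁₃CoPH F N → (ℕ → ℝ) → List (ULoop F) → ℕ,
      KeyedLive (fun F θ hP g₀ os => rateCarriersOfRecord₁₃CoPH 𝔯 F θ hP g₀ os (ksel F θ hP g₀ os)) ∧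
      ∀ (F : T4Family) (θ : Stage13HParams F N) (hP : θ.Provisos₁₃CoPH F N) (g₀ : ℕ → ℝ) (os : List (ULoop F)),
        N15At (rateCarriersOfRecord₁₃CoPH 𝔯 F θ hP g₀ os (ksel F θ hP g₀ os)).ne2 := by
  obtain ⟨r₀⟩ := nonempty_rateObjects₁₁ (N := N)
  let o : NE2Objects₁₁ := ⟨(fullPropCarriersEta L a m2 hm c35 p).I, c35, p, (fullPropCarriersEta L a m2 hm c35 p).pi, (fullPropCarriersEta L a m2 hm c35 p).Kop,
    (fullPropCarriersEta L a m2 hm c35 p).Ksite, (fullPropCarriersEta L a m2 hm c35 p).Kunit, (fullPropCarriersEta L a m2 hm c35 p).inΛ,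
    (fullPropCarriersEta L a m2 hm c35 p).unitDist⟩
  let 𝔯 : RateReading₁₃CoPH N :=
    ⟨fun _ _ _ _ _ => ⟨r₀.u3, r₀.ne3, fun _ => o⟩, fun _ _ _ _ _ => (⟨Empty, ⟨fun q => q.elim, fun q => q.elim, fun q => q.elim⟩, 0⟩ : NE1pCarriers)⟩
  have key := live_and_n15At_fullPropCarriersEta L hLodd hL ha hm hγ0 hγ1 c35 p
  exact ⟨𝔯, fun ksel => ⟨fun F θ hP _ _ g₀ os => key.1, fun F θ hP g₀ os => key.2⟩⟩

end Keyed

end Summit.QuantumFields.YangMills.BalabanUVNodes.N15KingModelRung.Curved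

end
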